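import Summits.ResolutionOfSingularities.ResolutionOfSingularities.Theorems.FrobeniusLadderFInjectiveMacaulayficationLocalFullificationFibreAdmGe4Split
import HarnessLib

/-!
# THE GERM FORM of the F-half (LF_adm-F): the input class `I = ⊤` («`S′ = Spec 𝒪_{X,x}` itself, an isolated Cohen–Macaulay singular point»)
# (crux `FInjectiveMacaulayfication` stmt-ResolutionOfSingularities-15315, chain w45a; res-L1-w45a-plan-1 NAMED OBJECT 02:05:01Z (offer (i) of
# res-L1-w45a-stub-1 02:01:22Z); res-L1-w45a-tri-2 rows #336/#337 «`I = ⊤` is a legal input; the DP4 towers are LITERAL instances»; seat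
# res-L1-w45a-stub-1 g8)

[OURS · L1 W4.5a] Support file (`--supports stmt-ResolutionOfSingularities-15315 --as helper`); replaces the role of NO printed item; NOT a
statement of the manuscript; NOT in the cone of door v36.2's `_proof`. **Target type for DP4-r1 certificate instances** (res-L1-w45a-idea-1 memo
`DP4-r1.md` 546a8aea4a391a6a / 666e4f211fe6aa1f: isolated F-degenerate double points `z² = B`, `d = 4`, `p = 3`: 1078/1104 specimens FULL-ified by
point-cosupported towers, 0 failures, 26 undecided). **The input class `I ≠ ⊤` (a genuine admissible blowing up `S′ → Spec 𝒪_{X,x}`, singular along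
positive-dimensional fibre strata) is NOT covered by anything in this file.** AI-written (AI review is weaker than expert review).

## What is here
The F-half of door v36.2's registered residue, (LF_adm-F) `LocalFullificationFibreAdmGe4Split.LocalFInjectivizationFibreAdmGe4` (res-L1-w45a-stub-2
p591179), quantifies over ALL admissible blowings up `g : S′ → Spec 𝒪_{X,x}` along `I ≠ ⊥` that are regular off the closed fibre and Cohen–Macaulay.
The input `I := ⊤` (unit ideal sheaf: `⊤ ≠ ⊥`; `supp ⊤ = ∅` is admissible vacuously; `𝟙` is a blowing up along `⊤`,
`Literature.AlgebraicGeometry.Resolution.isBlowup_id_top`) is LEGAL, and there the statement reads: *`x` a closed, non-regular point with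
`dim 𝒪_{X,x} = d` such that `Spec 𝒪_{X,x}` is regular off its closed point (an ISOLATED singularity) and satisfies the CM-clause at every point ⇒
there is `𝓚 ≠ ⊥` on `Spec 𝒪_{X,x}` cosupported at the closed point all of whose blowings up are FULL at every point.*

* `FInjectivizationGermAt p x` — the ∃-CONCLUSION at the point `x` (a predicate with parameters; the TYPE a certificate instance proves:
  «`∃ 𝓚 ≠ ⊥` on `Spec 𝒪_{X,x}`, `supp 𝓚 ⊆ {closed point}`, every blowing up along `𝓚` FULL everywhere»).
* `LocalFInjectivizationGerm p d` — [OURS · CANDIDATE statement] the F-half's body AT `S′ := Spec 𝒪_{X,x}`, `g := 𝟙`, `I := ⊤`, level `d`,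
  characteristic `p`, with the three trivial hypotheses (`⊤ ≠ ⊥`, admissibility of `⊤`, `IsBlowup 𝟙 ⊤`) removed and `(𝟙 _).base s` evaluated.
* PROVED: **`localFInjectivizationFibreAdmGe4_at_top_iff_germ`** — the LITERAL specialisation of the F-half's `∀` at `(Spec 𝒪_{X,x}, 𝟙, ⊤)` is
  EQUIVALENT to the germ form (currency certificate: a germ instance IS an F-half instance, res-L1-w45a-tri-2 #337);
  **`germ_of_localFInjectivizationFibreAdmGe4`** — (LF_adm-F) ⇒ the germ form at every `d ≥ 4` (so a REFUTED germ instance is census-NEGATIVE for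
  the F-half in exact currency); `fInjectivizationGermAt_of_model` — ONE blowing up along a point-cosupported `𝓚 ≠ ⊥` that is FULL everywhere
  suffices (all blowings up along `𝓚` are isomorphic over the base, `IsBlowup.unique`; FULL transports along stalk isomorphisms) — the entry point
  for certificates, which exhibit one model; `top_ne_bot_idealSheafData_Spec_stalk`, `support_top_subset` — the two trivial hypotheses.

[candidate statement, OURS; cite: Temkin2008, Prop. 2.3.4 (iii) (the admissible category); GortzWedhorn2020, (13.19) (`𝟙 = Bl_⊤`)]
-/

-- single-problem summit: the doubled namespace component is forced
set_option linter.dupNamespace false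

noncomputable section

open AlgebraicGeometry CategoryTheory CategoryTheory.Limits Literature.AlgebraicGeometry.Resolution TopologicalSpace IsLocalRing

namespace Summit.ResolutionOfSingularities.ResolutionOfSingularities.Theorems.FInjectiveMacaulayfication.GermForm

open Summit.ResolutionOfSingularities.ResolutionOfSingularities.Theorems.FInjectiveMacaulayfication
open SliceableCentre

/-! ## §1 The per-point target and the germ form -/

/-- **Point-cosupported F-injective FULL-ification of the germ at `x`** — the ∃-conclusion of the F-half (LF_adm-F) at the input
`S′ := Spec 𝒪_{X,x}`, `g := 𝟙`, `I := ⊤`: an ideal sheaf `𝓚 ≠ ⊥` on `Spec 𝒪_{X,x}` whose support is contained in the closed point, such that EVERY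
blowing up `π : S″ → Spec 𝒪_{X,x}` along `𝓚` is FULL (`SliceableCentre.FullCl p`: domain ∧ CM-clause ∧ Frobenius-closed parameter ideals) at
EVERY point. The TYPE of a DP4-r1 certificate instance (prove it with `fInjectivizationGermAt_of_model`). [OURS · definition of a target predicate] -/
def FInjectivizationGermAt (p : ℕ) {X : Scheme.{0}} (x : X) : Prop :=
  ∃ 𝓚 : (Spec (X.presheaf.stalk x)).IdealSheafData, 𝓚 ≠ ⊥ ∧
    (∀ s ∈ (𝓚.support : Set (Spec (X.presheaf.stalk x))), s = closedPoint (X.presheaf.stalk x)) ∧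
    ∀ (S'' : Scheme.{0}) (π : S'' ⟶ Spec (X.presheaf.stalk x)), IsBlowup π 𝓚 →
      ∀ s : S'', FullCl p (S''.presheaf.stalk s)

/-- [OURS · CANDIDATE statement, not a fact] **THE GERM FORM of (LF_adm-F) at level `d`, characteristic `p`** = the body of
`LocalFullificationFibreAdmGe4Split.LocalFInjectivizationFibreAdmGe4` at the input `S′ := Spec 𝒪_{X,x}`, `g := 𝟙`, `I := ⊤`
(`localFInjectivizationFibreAdmGe4_at_top_iff_germ`): for `X/k` integral separated of finite type (`char k = p`) and a CLOSED, NON-REGULAR point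
`x` with `dim 𝒪_{X,x} = d` such that `Spec 𝒪_{X,x}` is regular off its closed point (isolated singularity) and satisfies the CM-clause at every
point, `FInjectivizationGermAt p x` holds. The input class populated by res-L1-w45a-idea-1's DP4-r1 (isolated F-degenerate double points, `d = 4`).
Vacuous unless `p` is prime. «Candidate, not a claim; the class `I ≠ ⊤` of the F-half is NOT covered.» [candidate statement, OURS] -/
@[conjecture] def LocalFInjectivizationGerm (p d : ℕ) : Prop :=
  p.Prime → ∀ (k : Type) [Field k] [CharP k p]
    (X : Scheme.{0}) (f : X ⟶ Spec (.of k)),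
      IsSeparated f → LocallyOfFiniteType f → QuasiCompact f → IsIntegral X →
      ∀ x : X, IsClosed ({x} : Set X) → x ∉ Scheme.regularLocus X → ringKrullDim (X.presheaf.stalk x) = d →
        (∀ s : Spec (X.presheaf.stalk x), s ≠ closedPoint (X.presheaf.stalk x) →
          s ∈ Scheme.regularLocus (Spec (X.presheaf.stalk x))) →
        (∀ s : Spec (X.presheaf.stalk x), CMCl ((Spec (X.presheaf.stalk x)).presheaf.stalk s)) →
        FInjectivizationGermAt p x

/-! ## §2 The trivial hypotheses of the input `I = ⊤` -/

/-- On `Spec 𝒪_{X,x}` the unit ideal sheaf is not the zero ideal sheaf (their supports are `∅` and everything). [plumbing] -/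
theorem top_ne_bot_idealSheafData_Spec_stalk {X : Scheme.{0}} (x : X) :
    (⊤ : (Spec (X.presheaf.stalk x)).IdealSheafData) ≠ ⊥ := by
  intro h
  have hmem : closedPoint (X.presheaf.stalk x) ∈
      ((⊤ : (Spec (X.presheaf.stalk x)).IdealSheafData).support : Set (Spec (X.presheaf.stalk x))) := by
    rw [h, Scheme.IdealSheafData.support_bot]; trivial
  rw [Scheme.IdealSheafData.support_top] at hmem
  exact hmem

/-- The unit ideal sheaf is admissible (its support is empty). [plumbing] -/
theorem support_top_subset {Y : Scheme.{0}} (T : Set Y) :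
    ((⊤ : Y.IdealSheafData).support : Set Y) ⊆ T := by
  rw [Scheme.IdealSheafData.support_top]
  exact Set.empty_subset _

/-! ## §3 The literal specialisation of the F-half at `(Spec 𝒪_{X,x}, 𝟙, ⊤)` ⟺ the germ form -/

/-- **The F-half's `∀` at `S′ := Spec 𝒪_{X,x}`, `g := 𝟙`, `I := ⊤` ⟺ the germ form.** The left-hand side is the body of
`LocalFullificationFibreAdmGe4Split.LocalFInjectivizationFibreAdmGe4` at level `d` / characteristic `p` with `S′, g, I` INSTANTIATED VERBATIM
(checked by the kernel in `germ_of_localFInjectivizationFibreAdmGe4`, whose proof term is that instantiation); the right-hand side drops the three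
hypotheses that hold trivially (`top_ne_bot_idealSheafData_Spec_stalk`, `support_top_subset`, `isBlowup_id_top`) and evaluates `(𝟙 _).base s = s`.
[folklore; cite: GortzWedhorn2020, (13.19)] -/
theorem localFInjectivizationFibreAdmGe4_at_top_iff_germ (p d : ℕ) :
    (p.Prime → ∀ (k : Type) [Field k] [CharP k p]
      (X : Scheme.{0}) (f : X ⟶ Spec (.of k)),
        IsSeparated f → LocallyOfFiniteType f → QuasiCompact f → IsIntegral X →
        ∀ x : X, IsClosed ({x} : Set X) → x ∉ Scheme.regularLocus X → ringKrullDim (X.presheaf.stalk x) = d →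
          (⊤ : (Spec (X.presheaf.stalk x)).IdealSheafData) ≠ ⊥ →
          (((⊤ : (Spec (X.presheaf.stalk x)).IdealSheafData).support : Set (Spec (X.presheaf.stalk x))) ⊆
            (Scheme.regularLocus (Spec (X.presheaf.stalk x)))ᶜ) →
          IsBlowup (𝟙 (Spec (X.presheaf.stalk x))) (⊤ : (Spec (X.presheaf.stalk x)).IdealSheafData) →
          (∀ s : Spec (X.presheaf.stalk x), (𝟙 (Spec (X.presheaf.stalk x)) : _ ⟶ _).base s ≠ closedPoint (X.presheaf.stalk x) →
            s ∈ Scheme.regularLocus (Spec (X.presheaf.stalk x))) →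
          (∀ s : Spec (X.presheaf.stalk x), CMCl ((Spec (X.presheaf.stalk x)).presheaf.stalk s)) →
          ∃ 𝓚 : (Spec (X.presheaf.stalk x)).IdealSheafData, 𝓚 ≠ ⊥ ∧
            (∀ s ∈ (𝓚.support : Set (Spec (X.presheaf.stalk x))),
              (𝟙 (Spec (X.presheaf.stalk x)) : _ ⟶ _).base s = closedPoint (X.presheaf.stalk x)) ∧
            ∀ (S'' : Scheme.{0}) (π : S'' ⟶ Spec (X.presheaf.stalk x)), IsBlowup π 𝓚 →
              ∀ s : S'', FullCl p (S''.presheaf.stalk s)) ↔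
    LocalFInjectivizationGerm p d := by
  constructor
  · intro h hp k _ _ X f hsep hft hqc hint x hxcl hxs hx hiso hcm
    obtain ⟨𝓚, h1, h2, h3⟩ := h hp k X f hsep hft hqc hint x hxcl hxs hx (top_ne_bot_idealSheafData_Spec_stalk x)
      (support_top_subset _) (isBlowup_id_top _) (fun s hs => hiso s (by simpa using hs)) hcm
    exact ⟨𝓚, h1, fun s hs => by simpa using h2 s hs, h3⟩
  · intro h hp k _ _ X f hsep hft hqc hint x hxcl hxs hx _ _ _ hiso hcm
    obtain ⟨𝓚, h1, h2, h3⟩ := h hp k X f hsep hft hqc hint x hxcl hxs hx (fun s hs => hiso s (by simpa using hs)) hcm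
    exact ⟨𝓚, h1, fun s hs => by simpa using h2 s hs, h3⟩

/-- **(LF_adm-F) ⇒ the germ form** at every level `d ≥ 4` and characteristic `p`: instantiate the F-half's `∀` at `S′ := Spec 𝒪_{X,x}`, `g := 𝟙`,
`I := ⊤` (the proof term IS that instantiation — the kernel thereby certifies that the left-hand side of
`localFInjectivizationFibreAdmGe4_at_top_iff_germ` is the literal specialisation). Contrapositive use: a refuted instance of
`LocalFInjectivizationGerm p d` refutes the F-half. [folklore] -/
theorem germ_of_localFInjectivizationFibreAdmGe4 (h : LocalFullificationFibreAdmGe4Split.LocalFInjectivizationFibreAdmGe4)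
    {d : ℕ} (hd : 4 ≤ d) (p : ℕ) : LocalFInjectivizationGerm p d :=
  (localFInjectivizationFibreAdmGe4_at_top_iff_germ p d).mp
    fun hp k _ _ X f hsep hft hqc hint x hxcl hxs hx =>
      h d hd p hp k X f hsep hft hqc hint x hxcl hxs hx (Spec (X.presheaf.stalk x)) (𝟙 _) ⊤

/-! ## §4 Certificates: one FULL model suffices -/

/-- **One model suffices**: to prove `FInjectivizationGermAt p x` exhibit ONE blowing up `π₀ : S₀ → Spec 𝒪_{X,x}` along a point-cosupported
`𝓚 ≠ ⊥` with `S₀` FULL at every point — every other blowing up along `𝓚` is isomorphic to `S₀` over the base (`IsBlowup.unique`) and FULL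
transports along stalk isomorphisms (`FTemkinClosedPoints.fullCl_of_isIso_stalkMap'`). [folklore; cite: GortzWedhorn2020, Prop. 13.91 (1)] -/
theorem fInjectivizationGermAt_of_model (p : ℕ) {X : Scheme.{0}} (x : X)
    (𝓚 : (Spec (X.presheaf.stalk x)).IdealSheafData) (h𝓚 : 𝓚 ≠ ⊥)
    (hsupp : ∀ s ∈ (𝓚.support : Set (Spec (X.presheaf.stalk x))), s = closedPoint (X.presheaf.stalk x))
    {S₀ : Scheme.{0}} {π₀ : S₀ ⟶ Spec (X.presheaf.stalk x)} (hπ₀ : IsBlowup π₀ 𝓚)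
    (hfull : ∀ s : S₀, FullCl p (S₀.presheaf.stalk s)) :
    FInjectivizationGermAt p x := by
  refine ⟨𝓚, h𝓚, hsupp, fun S'' π hπ s => ?_⟩
  obtain ⟨e, -, -⟩ := hπ.unique hπ₀
  exact FTemkinClosedPoints.fullCl_of_isIso_stalkMap' p e.hom s (hfull (e.hom s))

/-- **The germ form from pointwise certificates**: if every closed non-regular point `x` (of the stated kind) of every `X` of the stated kind
satisfies `FInjectivizationGermAt p x`, the germ form holds — bookkeeping only (the hypotheses are handed to the certificate). [folklore] -/
theorem localFInjectivizationGerm_of_forall_at {p d : ℕ}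
    (h : ∀ (k : Type) [Field k] [CharP k p] (X : Scheme.{0}) (f : X ⟶ Spec (.of k)),
      IsSeparated f → LocallyOfFiniteType f → QuasiCompact f → IsIntegral X →
      ∀ x : X, IsClosed ({x} : Set X) → x ∉ Scheme.regularLocus X → ringKrullDim (X.presheaf.stalk x) = d →
        (∀ s : Spec (X.presheaf.stalk x), s ≠ closedPoint (X.presheaf.stalk x) →
          s ∈ Scheme.regularLocus (Spec (X.presheaf.stalk x))) →
        (∀ s : Spec (X.presheaf.stalk x), CMCl ((Spec (X.presheaf.stalk x)).presheaf.stalk s)) →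
        FInjectivizationGermAt p x) :
    LocalFInjectivizationGerm p d :=
  fun _ k _ _ X f hsep hft hqc hint x hxcl hxs hx hiso hcm => h k X f hsep hft hqc hint x hxcl hxs hx hiso hcm

end Summit.ResolutionOfSingularities.ResolutionOfSingularities.Theorems.FInjectiveMacaulayfication.GermForm

end
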